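import Literature.MathematicalPhysics.QuantumFieldTheory.Balaban1983to89.B8Prop5NestedServerPerBody
import Literature.MathematicalPhysics.QuantumFieldTheory.Balaban1983to89.B8SockHFPRDSrcGammaPrimePer
import Literature.MathematicalPhysics.QuantumFieldTheory.Balaban1983to89.B8SockSP5OfLettersSrc

/-!
# [B8] PROPOSITION 5 SERVED AT NESTED PERIODIC DOMAINS WITH THEOREM 8's SOURCE — the ∃-clause bodies of pub-ymgap's guarded sockets `SP5` ∕ `SP5base`
# (T5 `B8Thm4CoreZdGF3HP2PerLanEGamma`, instance (ii) `LanF a U₀ φ m W := LanF146 … φ m W`) at ONE member, ONE periodic pair, ONE periodic datum and ONE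
# periodic source, EDITION γ′ — the sourced b9 class law «box ⊂ Ω_{j−1}» (print's (1.31) class `towerBondsP`), (1.35) in the p. 77 one-end-point form
# (B8-P5-NESTED-SERVER, existence instance (ii), layer E-ii-4a′; r05 g96's E-ii-4a re-keyed by p21 g41 on the γ′ storey `B8SockHFPRDSrcGammaPrimePer`)

statement-level skeleton of published theorems with citation tags; proofs where landed; nothing here is a claim about the Yang–Mills mass gap

Bałaban, *Comm. Math. Phys.* **99** (1985) 75–102 ([B8]; PDF page = printed page − 74): Prop. 5 (1.106)–(1.110) p. 94, Thm 4 p. 88 ∕ p. 95, Thm 8 (1.146)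
p. 101, (1.66)–(1.69) p. 88, (1.29) p. 81, (1.31) + (1.35) p. 82, (1.57)–(1.59) p. 86, (1.86)–(1.88) p. 91, p. 77 («Ω_j ⊂ T_η»), (1.5)–(1.6) p. 77, p. 89
(«k = 1 also»), §3 p. 98; [3] Prop. 4 p. 38; [4] Thm 3.1 p. 397, (3.25) p. 394, Thm 3.3 p. 399.  `[Balaban1985RegularSpaces]`; PDF held:
`paper:balaban1985-cmp99-regular-spaces-gauge-fixing`.  STATUS: published, refereed.

CITATION HEADER (lean-in-tree rule).  Cell `lit-balaban`, seat `lit-balaban-p21` (g41) on r05 g96's hand-over (lit-balaban INBOX 2026-08-28T20:25:15Z «TAKE ALL THREE»);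
pub-ymgap IR B8-P5-NESTED-SERVER (dag-n05-c, pub-ymgap INBOX l.41793), existence instance (ii).  EDITION: p21 g41's kernel FIT TEST (lit-balaban INBOX 20:20:49Z ∕
20:25:09Z) of r05's staged server against the consumer's binder texts (T6c `B8Thm8SurvivingZdGF3HP2PerMapLanEGammaGuarded` p655863, T5
`B8Thm4CoreZdGF3HP2PerLanEGamma`) showed the consumer's sourced b9 socket `SH59src` lives over PRINT's class `towerBondsP L (ι a).Ω ((ι a).Λs m) ·`, reachable
only by instantiating the Λb-generic body at `towerBondsP` with `B8TowerBondsPrinted.ZdIdx.towerBondsP_laws` (box law «box ⊂ Ω_{j−1}») — hence this γ′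
edition of the body (r05's γ-less staged text, never filed, asked `hbox` at `Ω j`).  Text = r05's staged E-ii-4a (sha16 9281c1571bdfe181) with the γ′ delta of
dag-n05-w4's `B8SockSP5ProviderSrcGammaPrime.sp5_of_sockLettersRD_src_γ'` in §2 only; §1 and §3 VERBATIM.

WHY THIS FILE.  Lead g33's WAKE-B8P5NestedServerExist, instance (ii) «Theorem-8 source»: the same skeleton as this seat's instance-(i) body file
`B8Prop5NestedServerPerBody` (p658406) with dag-n05-d's ∕ dag-n05-w4's source deltas — §1 the sourced adapters `B8SockSP5OfLettersSrc.hP5_step_of_HFP_src`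
re-threaded with the rider `IsPeriodic P v` (gauge predicate `B8LanF146.LanF146 L k η Ω₀ Λs U₀ f`, = (1.146) `IsLandau146W` at the top level by
`lanF146_top_iff`; `lanF146_gaugeFixed_of_multiplier` + `lanF146_congr` in place of the (1.38) lemmas); §2–§3 the one-member bodies on the sourced periodic
storeys `B8SockHFPRDSrcGammaPrimePer.sockHFP_body_of_join_RD_src_γ'_per` (E-ii-3′, step, EDITION γ′: class law «box ⊂ Ω_{j−1}», tower law at truncation `m`,
(1.35) in T5's one-end-point form — passed through, no `endBlockIn_of_box` — windows `(L²α₀, L·α₂)`, `C₂` L²-scaled) ∕ `B8SockHFPRDSrcPer.sockHFP₀_body_of_join_RD_src_per`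
(E-ii-3, base: no class, no b9 input): the Landau predicate `LanF146 … f m U₁` at the
datum, the SOURCED b9 input `SH59m` (the two (1.59)-lines with source terms `Sa`, `Sg` for every PERIODIC masked exponent), the source `f` (in `R(U₀)` at the
top level — `InR138`, the adapter's input; Hermitian, `Bd2`-size `m_f`, `P`-periodic), `c_DA ≥ dL²(c⋆ + 2S_g)`, (1.103)∕(1.106) at `+ m_f∕2`.  No trace functional,
no group data (instance (ii) is `τ`-free by construction of E-ii-3).

THE LETTERS' LAWS DISPLAYED AS HYPOTHESES (nested `Ω_j`, periodic arguments; served by N06's periodic Green's-function line, not here): (E1) `g_rightΩ`, (E2)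
`c_range`, (1.91) `hQH`, (P) `hGper` ∕ `hqcq_per` ∕ `hHper`, exactly as in `B8Prop5NestedServerPerBody`.

WHAT THIS FILE PROVES (kernel, 0 sorry, theorems only): `sP5_step_of_HFP_src_per`, `sP5base_of_HFP_src_per` (§1); ★★ `sP5_body_of_join_src_γ'_per` (§2, edition γ′);
★★ `sP5base_body_of_join_src_per` (§3).

HONEST SCOPE ∕ A6.  Compositions of landed theorems; 0 new estimates.  [4]'s letters, their laws, the sourced (1.59) lines and the windows are HYPOTHESES
(N06 content at `m ≥ 1`); Prop 5, Sect. E, [4], [3] Prop. 10 NOT re-proved; no joint-satisfiability claim; `d ≥ 2`, `L ≥ 2`.  Count-neutral; N05 NOT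
discharged by a server; `T_η` read as `P`-periodic data on `ηℤᵈ`; one finite `T⁴` programme at fixed `ε` — nothing continuum ∕ ℝ⁴ ∕ OS ∕ mass-gap ∕ Clay:
the Yang–Mills mass gap is NOT proved here or by anything this file feeds.  No `sorry`, no `def`, no `instance`, no `notation`.
-/

noncomputable section

open NormedSpace
open scoped BigOperators
open Complex (I)

namespace Literature.MathematicalPhysics.QuantumFieldTheory.Balaban1983to89.B8Prop5NestedServerSrcPerBody

open MatrixLog (mlog)
open B7Prop1Explicit B7Prop2Explicit B7Prop1Local B7Eq92Concrete
open B7Prop2Explicit (C0 c2')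
open B7Prop3Flat (c3)
open B7Prop10General (C6 C4G)
open B7Prop9Flat (C5')
open B7Eq78Linearization (conjR zdBlocking QprimeIter)
open B8Ineq130 (tlo thi)
open B8Ineq132 (covDerivFwd covDeriv InAk BondTouches)
open B8Eq119TwistedAxial (Restr129 InAx bgT)
open B8Eq184Proof (gaugeExp cfgExp)
open B8Eq182Proof (gAd)
open B8Eq188Proof (frakF3)
open B8Lemma1NonAbelian (mulCfg)
open B8Eq140Level (SideTouches)
open B8Thm2LogB (blockTop)
open B8Eq138LandauZd (IsLandau138W InR138 covDivB covLap QT)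
open B8Ineq125Concrete (C2p)
open B8Eq1117Concrete (XSpace)
open B8Prop5ContractionKLevel (Bd2 Mc Kc)
open B8LambdaSpaceKLevel (wt)

open B8LanF146 (LanF146 lanF146_gaugeFixed_of_multiplier)
open B8SockSP5OfLettersSrc (lanF146_congr)
open B8Thm4TruncationLocal (base_datum)
open B8SockHFPRDSrcPer (sockHFP₀_body_of_join_RD_src_per)
open B8SockHFPRDSrcGammaPrimePer (sockHFP_body_of_join_RD_src_γ'_per)
open B8Prop5NestedServerPerBody (per_dir_of_isPeriodic gaugeExp_isPeriodic)
open B8Eq155JBound (Jcur wsup)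
open B7Prop4GeneralLevels (linCovIter)
open B8ScaledSupNorm (bondNorm msup)
open B8Eq146AExpansion (iEta)
open B8PeriodicMemberGeometry (sideTouches_add_zsmul_iff)
open T4TermwiseTorus (IsPeriodic)
open B8LeafModelZd3SockPer (isPeriodic_of_forall_shift_e)
open B8Thm2TorusServerPer (gaugeExp_per)
open QuantumLattice (blockSites)

-- `Site` alone could resolve to the torus sites of `Setup.lean`; re-export the `ℤ^d` sites of `B7Prop1Explicit`.
export B7Prop1Explicit (Site)

variable {d : ℕ}


/-! ## §1 The SOURCED support-form ∃-clauses WITH the periodicity rider, from a periodic sourced fixed point in plain currency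
(`B8SockSP5OfLettersSrc.hP5_step_of_HFP_src` re-threaded; `v := e^{iλ}`; gauge predicate `LanF146`) -/

section Adapters

/-- In `d ≥ 2` a bond with an end-point in `S` is a side of a plaquette touching `S` (p. 77 convention «b ∈ Ω»).
[cite: Balaban1985RegularSpaces, p.77 (convention before (1.5))] -/
private theorem sideTouches_of_bondTouches₂ (hd2 : 2 ≤ d) {S : Set (Site d)} {y : Site d} {τ : Fin d}
    (hb : BondTouches S y τ) : SideTouches S y τ := by
  haveI : Nontrivial (Fin d) := Fin.nontrivial_iff_two_le.mpr hd2
  obtain ⟨κ, hκ⟩ := exists_ne τ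
  exact B8Eq140Level.sideTouches_of_bondTouches hκ hb

variable {𝔸 : Type*} [CStarAlgebra 𝔸] [Nontrivial 𝔸]

/-- ★ **THE PROPOSITION-5 STEP IN PLAIN CURRENCY, PERIODIC, ⇒ THE SUPPORT-FORM ∃-CLAUSE OF `SP5` WITH THE RIDER `IsPeriodic P v`** (one level, any `m`;
`B8SockSP5OfLettersSrc.hP5_step_of_HFP_src` verbatim plus periodicity).  Given the level-`m` datum — `U₁ = e^{iηA}` on the bonds of the plaquettes touching `Ω_j`,
`A` Hermitian, `|A| ≤ c⋆(Lʲη)⁻¹` — and a fixed point `λ` displayed in plain currency AND periodic in every direction (`λ(z + P e_i) = λ(z)`; the output of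
`B8SockHFPRDSrcPer.sockHFP_body_of_join_RD_src_per`, whose contraction runs on the periodic subspace): `λ` Hermitian, `= 0` off `Ω₀`, (1.108) at
the `m + 1` levels, the multiplier form of (1.146) (`… − f`) for the right-hand side of the D*-identity (1.86)–(1.88), (1.29) at `m + 1` levels for
`u₁·e^{iλ}` — the gauge transformation `v := e^{iλ}` is unitary (`B8Ineq170.exp_I_smul_mem_unitary`), `= 1` off `Ω₀`, reads `e^{iλ}` on every bond, obeys
(1.108), `U₁^{v⁻¹}` satisfies THEOREM 8's SOURCED GAUGE PREDICATE `LanF146 … f (m + 1)` (`B8LanF146.lanF146_gaugeFixed_of_multiplier` at `e^{iηA}`, transported to `U₁` by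
`B8SockSP5OfLettersSrc.lanF146_congr`; the source `f ∈ R(U₀)` at the top level, `hf`; the
smallness at the sites of `Ω₀` read off (1.108) and the datum at level `0`: `α₄ ≤ 1∕84`, `c⋆ ≤ 1∕12`), (1.29) holds for `u₁·v`, AND `v` IS `P`-PERIODIC
(`gaugeExp_isPeriodic`). [cite: Balaban1985RegularSpaces, Prop. 5 pp.93–94, (1.107)–(1.108) p.94, (1.86)–(1.88) p.91, Thm 8 (1.146) p.101, (1.29) p.81, p.77 («Ω_j ⊂ T_η»)] -/
theorem sP5_step_of_HFP_src_per (hd2 : 2 ≤ d) {η : ℝ} (hη : 0 < η) (L k m : ℕ) {P : ℕ} {U₀ : Site d → Fin d → 𝔸ˣ}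
    (hU₀ : ∀ x κ, U₀ x κ ∈ unitaryUnits 𝔸) {cstar α₄ : ℝ} (hs₁ : α₄ ≤ 1 / 84) (hcs : cstar ≤ 1 / 12)
    (Ω : ℕ → Set (Site d)) (Λs : ℕ → ℕ → Set (Site d)) (u₁ : Site d → 𝔸ˣ) (U₁ : Site d → Fin d → 𝔸ˣ) (A : Site d → Fin d → 𝔸)
    (f : Site d → 𝔸) (hf : InR138 L k η (Ω 0) (Λs k) U₀ f)
    (hdat : ∀ j, j ≤ m → ∀ b ∈ {b : Site d × Fin d | SideTouches (Ω j) b.1 b.2},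
      U₁ b.1 b.2 = cfgExp η A b.1 b.2 ∧ IsSelfAdjoint (A b.1 b.2) ∧ ‖A b.1 b.2‖ ≤ cstar * ((L : ℝ) ^ j * η)⁻¹)
    (hFP : ∃ lam : Site d → 𝔸, (∀ (z : Site d) (i : Fin d), lam (z + (P : ℤ) • e i) = lam z) ∧
      (∀ x, IsSelfAdjoint (lam x)) ∧ (∀ x, x ∉ Ω 0 → lam x = 0) ∧
      (∀ j, j ≤ m + 1 → ∀ b ∈ {b : Site d × Fin d | SideTouches (Ω j) b.1 b.2},
        ‖lam b.1‖ ≤ α₄ ∧ ((L : ℝ) ^ j * η) * ‖covDerivFwd η U₀ b.2 lam b.1‖ ≤ α₄) ∧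
      (∃ μ : ℕ → Site d → 𝔸, ∀ x ∈ Ω 0,
        covLap η U₀ ((Ω 0).indicator fun y => covDivB η U₀ A y + covLap η U₀ lam y +
          ((conjR (gaugeExp lam y)⁻¹ (covDivB η U₀ A y) - covDivB η U₀ A y) +
            (gAd (covLap η U₀ lam y) (lam y) - covLap η U₀ lam y) + ∑ μ, frakF3 η U₀ lam A y μ) - f y) x =
          QT L (m + 1) (Λs (m + 1)) U₀ μ x) ∧
      Restr129 L (m + 1) (Λs (m + 1)) U₀ (u₁ * gaugeExp lam)) :
    ∃ (v : Site d → 𝔸ˣ) (lam : Site d → 𝔸), (∀ x, v x ∈ unitaryUnits 𝔸) ∧ (∀ x, x ∉ Ω 0 → v x = 1) ∧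
      (∀ j, j ≤ m + 1 → ∀ b ∈ {b : Site d × Fin d | SideTouches (Ω j) b.1 b.2}, (v b.1 : 𝔸) = ((gaugeExp lam b.1 : 𝔸ˣ) : 𝔸) ∧
        (v (b.1 + e b.2) : 𝔸) = ((gaugeExp lam (b.1 + e b.2) : 𝔸ˣ) : 𝔸)) ∧
      (∀ j, j ≤ m + 1 → ∀ b ∈ {b : Site d × Fin d | SideTouches (Ω j) b.1 b.2},
        ‖lam b.1‖ ≤ α₄ ∧ ((L : ℝ) ^ j * η) * ‖covDerivFwd η U₀ b.2 lam b.1‖ ≤ α₄) ∧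
      LanF146 L k η (Ω 0) Λs U₀ f (m + 1) (mgauge U₀ v⁻¹ U₁) ∧ Restr129 L (m + 1) (Λs (m + 1)) U₀ (u₁ * v) ∧
      IsPeriodic P v := by
  obtain ⟨lam, hlamP, hsa, hoff, h108, hmult, h129⟩ := hFP
  have hE0 : ∀ {y : Site d} {τ : Fin d}, BondTouches (Ω 0) y τ → (y, τ) ∈ {b : Site d × Fin d | SideTouches (Ω 0) b.1 b.2} :=
    fun hb => sideTouches_of_bondTouches₂ hd2 hb
  have hα12 : α₄ ≤ 1 / 12 := hs₁.trans (by norm_num)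
  have hα70 : α₄ ≤ 1 / 70 := hs₁.trans (by norm_num)
  have hd1 : 0 < d := by omega
  -- (1.108) at level `j = 0` on the bonds touching `Ω₀`
  have h0 : ∀ y τ, BondTouches (Ω 0) y τ → ‖lam y‖ ≤ α₄ ∧ η * ‖covDerivFwd η U₀ τ lam y‖ ≤ α₄ := fun y τ hb => by
    simpa only [pow_zero, one_mul] using h108 0 (Nat.zero_le _) (y, τ) (hE0 hb)
  have hl : ∀ x ∈ Ω 0, ‖lam x‖ ≤ 1 / 12 := fun x hx => (h0 x ⟨0, hd1⟩ (Or.inl hx)).1.trans hα12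
  have hD : ∀ x ∈ Ω 0, ∀ μ, η * ‖covDerivFwd η U₀ μ lam x‖ ≤ 1 / 70 := fun x hx μ => (h0 x μ (Or.inl hx)).2.trans hα70
  have hback : ∀ x ∈ Ω 0, ∀ μ : Fin d, BondTouches (Ω 0) (x - e μ) μ := fun x hx μ => Or.inr (by rwa [sub_add_cancel])
  have ha : ∀ x ∈ Ω 0, ∀ μ, η * ‖covDeriv η U₀ μ lam x‖ ≤ 1 / 70 := fun x hx μ => by
    rw [B8Eq151V2Divergence.norm_covDeriv_eq (unitaryUnits_le_U1 (hU₀ _ _)) lam]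
    exact (h0 _ μ (hback x hx μ)).2.trans hα70
  have hY : ∀ x ∈ Ω 0, ∀ μ, η * ‖conjR (U₀ (x - e μ) μ)⁻¹ (A (x - e μ) μ)‖ ≤ 1 / 12 := fun x hx μ => by
    obtain ⟨-, -, hA⟩ := hdat 0 (Nat.zero_le _) (x - e μ, μ) (hE0 (hback x hx μ))
    rw [B8Ineq132.norm_conjR ((U1 𝔸).inv_mem (unitaryUnits_le_U1 (hU₀ _ _)))]
    rw [pow_zero, one_mul] at hA
    calc η * ‖A (x - e μ) μ‖ ≤ η * (cstar * η⁻¹) := mul_le_mul_of_nonneg_left hA hη.le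
      _ = cstar := by rw [mul_left_comm, mul_inv_cancel₀ hη.ne', mul_one]
      _ ≤ 1 / 12 := hcs
  have hLan : LanF146 L k η (Ω 0) Λs U₀ f (m + 1) (mgauge U₀ (gaugeExp lam)⁻¹ (cfgExp η A)) :=
    lanF146_gaugeFixed_of_multiplier hη L k (m + 1) (Ω 0) Λs U₀ A f hf hl hD ha hY hmult
  have hcongr : ∀ (x : Site d) (μ : Fin d), BondTouches (Ω 0) x μ →
      mgauge U₀ (gaugeExp lam)⁻¹ U₁ x μ = mgauge U₀ (gaugeExp lam)⁻¹ (cfgExp η A) x μ := fun x μ hb => by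
    rw [mgauge_apply, mgauge_apply, (hdat 0 (Nat.zero_le _) (x, μ) (hE0 hb)).1]
  refine ⟨gaugeExp lam, lam, fun x => ?_, fun x hx => ?_, fun j _ b _ => ⟨rfl, rfl⟩, h108,
    (lanF146_congr hcongr).mpr hLan, h129, gaugeExp_isPeriodic hlamP⟩
  · exact mem_unitaryUnits.mpr (B8Ineq170.exp_I_smul_mem_unitary (hsa x))
  · exact Units.ext (by rw [gaugeExp, hoff x hx, smul_zero, val_expUnit, NormedSpace.exp_zero, Units.val_one])

/-- ★ **THE BASE (`u₁ = 1`, `U₁ = U′`, p. 89 «k = 1 also») IN PLAIN CURRENCY, PERIODIC, ⇒ THE SUPPORT-FORM ∃-CLAUSE OF `SP5base` WITH THE RIDER `IsPeriodic P v`**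
(the sourced twin of `B8Prop5KLevelLetters.hP5base_of_HFP`, plus periodicity): by the (1.66)₀ side clause `|U′ − 1| ≤ a ≤ 1∕4` on the bonds of the plaquettes touching `Ω₀`,
`U′ = e^{iηA₀}` there with `A₀ := (iη)⁻¹ log U′` Hermitian and `|A₀| ≤ 2aη⁻¹ ≤ c⋆η⁻¹` (`B8Thm4TruncationLocal.base_datum`) — the datum of level `0`, PERIODIC IN EVERY
DIRECTION BECAUSE `U′` IS — and the periodic plain-currency fixed point `HFP₀` for that datum gives the clause by `sP5_step_of_HFP_src_per` at `m = 0`.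
[cite: Balaban1985RegularSpaces, Prop. 5 pp.93–94, (1.66) p.88, p.89, (1.107)–(1.108) p.94, Thm 8 (1.146) p.101, p.77 («Ω_j ⊂ T_η»)] -/
theorem sP5base_of_HFP_src_per (hd2 : 2 ≤ d) {η : ℝ} (hη : 0 < η) (L k : ℕ) {P : ℕ} {U₀ U' : Site d → Fin d → 𝔸ˣ}
    (hU₀ : ∀ x κ, U₀ x κ ∈ unitaryUnits 𝔸) (hU' : ∀ x κ, U' x κ ∈ unitaryUnits 𝔸)
    (hU'p : ∀ (z : Site d) (i : Fin d), U' (z + (P : ℤ) • e i) = U' z)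
    {cstar α₄ a : ℝ} (hs₁ : α₄ ≤ 1 / 84)
    (hcs : cstar ≤ 1 / 12) (ha : a ≤ 1 / 4) (ha2 : 2 * a ≤ cstar) (Ω : ℕ → Set (Site d)) (Λs : ℕ → ℕ → Set (Site d))
    (f : Site d → 𝔸) (hf : InR138 L k η (Ω 0) (Λs k) U₀ f)
    (h66 : ∀ b ∈ {b : Site d × Fin d | SideTouches (Ω 0) b.1 b.2}, ‖((U' b.1 b.2 : 𝔸ˣ) : 𝔸) - 1‖ ≤ a)
    (HFP₀ : ∀ A : Site d → Fin d → 𝔸, (∀ (z : Site d) (i : Fin d), A (z + (P : ℤ) • e i) = A z) →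
      (∀ j, j ≤ 0 → ∀ b ∈ {b : Site d × Fin d | SideTouches (Ω j) b.1 b.2},
        U' b.1 b.2 = cfgExp η A b.1 b.2 ∧ IsSelfAdjoint (A b.1 b.2) ∧ ‖A b.1 b.2‖ ≤ cstar * ((L : ℝ) ^ j * η)⁻¹) →
      ∃ lam : Site d → 𝔸, (∀ (z : Site d) (i : Fin d), lam (z + (P : ℤ) • e i) = lam z) ∧
        (∀ x, IsSelfAdjoint (lam x)) ∧ (∀ x, x ∉ Ω 0 → lam x = 0) ∧
        (∀ j, j ≤ 1 → ∀ b ∈ {b : Site d × Fin d | SideTouches (Ω j) b.1 b.2},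
          ‖lam b.1‖ ≤ α₄ ∧ ((L : ℝ) ^ j * η) * ‖covDerivFwd η U₀ b.2 lam b.1‖ ≤ α₄) ∧
        (∃ μ : ℕ → Site d → 𝔸, ∀ x ∈ Ω 0,
          covLap η U₀ ((Ω 0).indicator fun y => covDivB η U₀ A y + covLap η U₀ lam y +
            ((conjR (gaugeExp lam y)⁻¹ (covDivB η U₀ A y) - covDivB η U₀ A y) +
              (gAd (covLap η U₀ lam y) (lam y) - covLap η U₀ lam y) + ∑ μ, frakF3 η U₀ lam A y μ) - f y) x =
            QT L 1 (Λs 1) U₀ μ x) ∧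
        Restr129 L 1 (Λs 1) U₀ ((1 : Site d → 𝔸ˣ) * gaugeExp lam)) :
    ∃ (v : Site d → 𝔸ˣ) (lam : Site d → 𝔸), (∀ x, v x ∈ unitaryUnits 𝔸) ∧ (∀ x, x ∉ Ω 0 → v x = 1) ∧
      (∀ j, j ≤ 1 → ∀ b ∈ {b : Site d × Fin d | SideTouches (Ω j) b.1 b.2}, (v b.1 : 𝔸) = ((gaugeExp lam b.1 : 𝔸ˣ) : 𝔸) ∧
        (v (b.1 + e b.2) : 𝔸) = ((gaugeExp lam (b.1 + e b.2) : 𝔸ˣ) : 𝔸)) ∧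
      (∀ j, j ≤ 1 → ∀ b ∈ {b : Site d × Fin d | SideTouches (Ω j) b.1 b.2},
        ‖lam b.1‖ ≤ α₄ ∧ ((L : ℝ) ^ j * η) * ‖covDerivFwd η U₀ b.2 lam b.1‖ ≤ α₄) ∧
      LanF146 L k η (Ω 0) Λs U₀ f 1 (mgauge U₀ v⁻¹ U') ∧ Restr129 L 1 (Λs 1) U₀ ((1 : Site d → 𝔸ˣ) * v) ∧
      IsPeriodic P v := by
  set A₀ : Site d → Fin d → 𝔸 := fun y μ => η⁻¹ • ((I⁻¹ : ℂ) • mlog ((U' y μ : 𝔸ˣ) : 𝔸))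
  have hA₀p : ∀ (z : Site d) (i : Fin d), A₀ (z + (P : ℤ) • e i) = A₀ z := fun z i => by
    funext μ
    simp only [A₀, hU'p z i]
  have hdat : ∀ j, j ≤ 0 → ∀ b ∈ {b : Site d × Fin d | SideTouches (Ω j) b.1 b.2},
      U' b.1 b.2 = cfgExp η A₀ b.1 b.2 ∧ IsSelfAdjoint (A₀ b.1 b.2) ∧ ‖A₀ b.1 b.2‖ ≤ cstar * ((L : ℝ) ^ j * η)⁻¹ := by
    intro j hj b hb
    obtain rfl : j = 0 := Nat.le_zero.mp hj
    obtain ⟨-, hexp, hsa, hn⟩ := base_datum hη U₀ U' hU' ha b.1 b.2 (h66 b hb)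
    refine ⟨hexp, hsa, hn.trans ?_⟩
    rw [pow_zero, one_mul]
    exact mul_le_mul_of_nonneg_right ha2 (inv_nonneg.mpr hη.le)
  exact sP5_step_of_HFP_src_per hd2 hη L k 0 hU₀ hs₁ hcs Ω Λs 1 U' A₀ f hf hdat (HFP₀ A₀ hA₀p hdat)

end Adapters

/-! ## §2 T5's `SP5` ∃-clause (instance (ii)) at ONE member, ONE periodic pair, ONE periodic level-`m` datum and ONE periodic source, from the
nested periodic sourced ∃λ-storey, EDITION γ′ (`B8SockHFPRDSrcGammaPrimePer.sockHFP_body_of_join_RD_src_γ'_per`) -/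

section Step

variable {𝔸 : Type*} [CStarAlgebra 𝔸] [Nontrivial 𝔸]

/-- ★★ **EDITION γ′ (class law «box ⊂ Ω_{j−1}» `hbox`; tower law at truncation `m` `htowm`; (1.35) in T5's one-end-point form passed through; `C₂` L²-scaled; three more windows `hα3L hα4L hsmallL`; storey `sockHFP_body_of_join_RD_src_γ'_per`) OF: PROPOSITION 5, EXISTENCE (1.107)–(1.108) AT LEVEL `m + 1`, NESTED PERIODIC DOMAINS — THE ∃-CLAUSE OF pub-ymgap's GUARDED SOCKET `SP5`
(T5 `B8Thm4CoreZdGF3HP2PerLanEGamma` :131–:149, instance (ii) `LanF a U₀ φ m W := LanF146 … φ m W`) AT ONE MEMBER, ONE PERIODIC UNITARY PAIR AND ONE PERIODIC LEVEL-`m` DATUM.**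
For `d, L ≥ 2`, a member `(η, k, Ω, Λs, Λb)` with its laws (nesting (1.3), the class bonds of the (1.42) lemma `hbox ∕ hclass`, towers «Bʲ(y) ⊂ Ω_j» at the
truncation `m + 1`, the truncation relations `hlt ∕ htop` between the level-`m` and level-`(m+1)` families), `1 ≤ m < k`, a unitary pair `(U₀, U′)` with `U₀`
`P`-periodic in Theorem 4's regime ((1.33), (1.34), all-truncation axial gauge, the (1.35)-closeness in the end-block form, passed to the γ′ storey as is), a PERIODIC level-`m` datum `(u₁, U₁ = U′^{u₁⁻¹}, A)` ((1.29)_m, (1.38)_m, (1.69): `U₁ = e^{iηA}` Hermitian with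
`|A| ≤ c⋆(Lʲη)⁻¹` on the bonds of the plaquettes touching `Ω_j`, `j ≤ m`, `c⋆ = 5dLB₈(α₀ + α₁)`), the torus data (`Lʲ ∣ P`, `Λ_j^{(m+1)}` shift-invariant, `Ω_j`
`P`-periodic), the SOURCED b9 input at level `m` ([4] Thm 3.3 + (1.57)–(1.58) with source terms `Sa`, `Sg`, for periodic masked exponents), Theorem 8's source `f` (`R(U₀)` at the top level, Hermitian, `Bd2`-size `m_f`, periodic), the sourced gauge predicate `LanF146 … f m U₁` at the datum, THE [4] LETTERS AT `(m + 1, U₀)` WITH THEIR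
LAWS (E1) ∕ (E2) ∕ (1.91) AT PERIODIC ARGUMENTS AND (P) (module docstring), and the JOIN's scalar windows one-for-one at `α₄ = 8B₀′(5dLB₈)(α₀ + α₁)`: THERE ARE a
unitary `P`-PERIODIC `v = e^{iλ}`, `= 1` off `Ω₀`, reading `e^{iλ}` on the bonds of the plaquettes touching `Ω_j` (`j ≤ m + 1`), with (1.108) graded «on Ω_j» at
`α₄`, the sourced gauge predicate `LanF146 … f (m + 1)` for `U₁^{v⁻¹}` and (1.29) for `u₁·v` at `m + 1` levels — i.e. the ∃-clause of `SP5` at instance (ii).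
PROOF: the sourced γ′ storey `B8SockHFPRDSrcGammaPrimePer.sockHFP_body_of_join_RD_src_γ'_per` gives the periodic plain-currency fixed point; `sP5_step_of_HFP_src_per`
converts it (`α₄ ≤ 1∕84` from the window `200·C₆·2α₄ ≤ 1`, `C₆ ≥ 2`; `c⋆ ≤ 1∕12` from `L·c⋆ ≤ c_B`, `40d·c_B ≤ 1∕200`).
[cite: Balaban1985RegularSpaces, Prop. 5 (1.107)–(1.108) p.94, Thm 4 p.88, Thm 8 (1.146) p.101, (1.57)–(1.59) p.86, (1.68)–(1.69) p.88, (1.86)–(1.88) p.91, (1.113)–(1.121) pp.95–97, (1.38) p.82, (1.29) p.81, p.77 («Ω_j ⊂ T_η»); Balaban1985BackgroundPropagators, Thm 3.1 p.397, Thm 3.3 p.399, (3.19) p.393; Balaban1985Averaging, Prop. 10, (213) p.48] -/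
theorem sP5_body_of_join_src_γ'_per (hd2 : 2 ≤ d) {L : ℕ} (hL : 2 ≤ L) {η : ℝ} (hη : 0 < η) (P : ℕ) {k : ℕ}
    -- the member's geometry
    {Ω : ℕ → Set (Site d)} (hΩ : ∀ j, Ω (j + 1) ⊆ Ω j) {Λs : ℕ → ℕ → Set (Site d)} {Λb : ℕ → ℕ → Set (Site d × Fin d)}
    -- PRINT's box law: the locality box of a datum bond of level `j` lies in `Ω_{j−1}` ((1.31); level 0: `Ω₀`) — `ZdIdx.towerBondsP_laws ·|>.1` at `towerBondsP`
    (hbox : ∀ m, m ≤ k → ∀ j, j ≤ m → ∀ c ∈ Λb m j, ∀ x, InBox (loK L j c.1) (bondHiK L j c.1 c.2) x → x ∈ Ω (j - 1))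
    (hclass : ∀ m, m ≤ k → ∀ j, j ≤ m → ∀ c ∈ Λb m j,
      (c.1 ∈ Λs m j ∧ c.1 + e c.2 ∈ Λs m j) ∨
      (∃ j', j = j' + 1 ∧ (∀ x, (L : ℤ) • c.1 ≤ x → x ≤ (L : ℤ) • c.1 + blockTop L → x ∈ Λs m j') ∧ c.1 + e c.2 ∈ Λs m j) ∨
      (∃ j', j = j' + 1 ∧ c.1 ∈ Λs m j ∧ (∀ x, (L : ℤ) • (c.1 + e c.2) ≤ x → x ≤ (L : ℤ) • (c.1 + e c.2) + blockTop L → x ∈ Λs m j')))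
    {m : ℕ} (hm1 : 1 ≤ m) (hmk : m < k)
    (htower : ∀ j, j ≤ m + 1 → ∀ y ∈ Λs (m + 1) j, ∀ x, InBox (tlo L y j) (thi L y j) x → x ∈ Ω j)
    (hlt : ∀ j, j < m → Λs m j = Λs (m + 1) j)
    (htop : ∀ x, x ∈ Λs m m ↔ x ∈ Λs (m + 1) m ∨ ∃ y ∈ Λs (m + 1) (m + 1), x ∈ blockSites L y)
    -- EDITION γ′: the tower law AT THE DATUM's TRUNCATION `m` ((1.5)–(1.6) p. 77) — what `H42_of_inAx_γ'` asks
    (htowm : ∀ j, j ≤ m → ∀ y ∈ Λs m j, ∀ x, InBox (tlo L y j) (thi L y j) x → x ∈ Ω j)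
    -- the socket's antecedents: constants, (1.33), (1.34), (1.35)/(1.66)
    {α₀ α₁ B₈ B₀' cs α₄ : ℝ} (hα₀ : 0 < α₀) (hα₁ : 0 < α₁) (hB₈ : 0 < B₈) (hB₀' : 0 < B₀')
    (hcs_def : cs = 5 * (d : ℝ) * L * B₈ * (α₀ + α₁)) (hα₄_def : α₄ = 8 * B₀' * (5 * (d : ℝ) * L * B₈) * (α₀ + α₁))
    {U₀ U' : Site d → Fin d → 𝔸ˣ} (hU₀ : ∀ x κ, U₀ x κ ∈ unitaryUnits 𝔸) (hU' : ∀ x κ, U' x κ ∈ unitaryUnits 𝔸) (hU₀p : IsPeriodic P U₀)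
    (h33 : InAk L k η α₀ Ω U₀) (h34 : InAk L k η α₀ Ω (mulCfg U' U₀)) (hAx : ∀ m', m' ≤ k → InAx L m' (Λs m') U₀ (mulCfg U' U₀))
    (h135 : ∀ j, j ≤ k → ∀ (z : Site d) (μ : Fin d),
      ((∀ x, InBox (tlo L z j) (thi L z j) x → x ∈ Ω j) ∨ (∀ x, InBox (tlo L (z + e μ) j) (thi L (z + e μ) j) x → x ∈ Ω j)) →
      ‖(avgIter L (mulCfg U' U₀) j z μ : 𝔸) - (avgIter L U₀ j z μ : 𝔸)‖ ≤ α₁)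
    -- the PERIODIC datum at level `m`
    {u₁ : Site d → 𝔸ˣ} {U₁ : Site d → Fin d → 𝔸ˣ} {A : Site d → Fin d → 𝔸}
    (hu₁ : ∀ x, u₁ x ∈ unitaryUnits 𝔸) (hu₁p : IsPeriodic P u₁) (hAp : IsPeriodic P A) (hW : mgauge U₀ u₁ U₁ = U') (h129 : Restr129 L m (Λs m) U₀ u₁)
    -- THEOREM 8's SOURCE `f`: in `R(U₀)` at the top level ((1.146)'s range clause), Hermitian, `Bd2`-size `m_f` on the `Ω_j` (`j ≤ m + 1`), `P`-PERIODIC;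
    -- the datum satisfies the sourced gauge predicate `LanF146 … f m`
    {f : Site d → 𝔸} (hf138 : InR138 L k η (Ω 0) (Λs k) U₀ f) {mf : ℝ} (hmf : 0 ≤ mf) (hfB : Bd2 L η (m + 1) Ω f mf)
    (hfsa : ∀ j, j ≤ m + 1 → ∀ x ∈ Ω j, IsSelfAdjoint (f x)) (hfp : IsPeriodic P f)
    (hLan : LanF146 L k η (Ω 0) Λs U₀ f m U₁)
    (hdat : ∀ j, j ≤ m → ∀ b ∈ {b : Site d × Fin d | SideTouches (Ω j) b.1 b.2},
      U₁ b.1 b.2 = cfgExp η A b.1 b.2 ∧ IsSelfAdjoint (A b.1 b.2) ∧ ‖A b.1 b.2‖ ≤ cs * ((L : ℝ) ^ j * η)⁻¹)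
    -- THE SOURCED b9 INPUT AT THE DATUM ([4] Thm 3.3 + (1.57)–(1.58) for the sourced gauge condition at level `m`: the two (1.59)-lines WITH SOURCE TERMS
    -- `Sa`, `Sg` for every PERIODIC masked exponent of `U₁` — what T5's `SH59src` delivers at `(m, u₁, U₁)`)
    {Sa Sg : ℝ} (hSg : 0 ≤ Sg)
    (SH59m : ∀ A' : Site d → Fin d → 𝔸, IsPeriodic P A' → (∀ y τ, IsSelfAdjoint (A' y τ)) →
      (∀ j, j ≤ m → ∀ (y : Site d) (τ : Fin d), SideTouches (Ω j) y τ → U₁ y τ = cfgExp η A' y τ ∧ ‖A' y τ‖ ≤ cs * ((L : ℝ) ^ j * η)⁻¹) →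
      (∀ (y : Site d) (τ : Fin d), (∀ j, j ≤ m → ¬ SideTouches (Ω j) y τ) → A' y τ = 0) →
      msup L m η (-(1 : ℝ)) (fun j (b : Site d × Fin d) => SideTouches (Ω j) b.1 b.2) (fun b => A' b.1 b.2)
          ≤ B₈ * (bondNorm L m η (-(3 : ℝ)) Ω (fun x μ => Jcur η U₀ A' μ x)
          + wsup 1 (fun p : {p : ℕ × (Site d × Fin d) // p.1 ≤ m ∧ p.2 ∈ Λb m p.1} =>
          linCovIter L U₀ (iEta η A') p.1.1 p.1.2.1 p.1.2.2)) + Sa ∧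
        msup L m η (-(2 : ℝ)) (fun j (t : Fin d × Fin d × Site d) => SideTouches (Ω j) t.2.2 t.2.1)
          (fun t => covDerivFwd η U₀ t.1 (fun z => A' z t.2.1) t.2.2)
          ≤ B₈ * (bondNorm L m η (-(3 : ℝ)) Ω (fun x μ => Jcur η U₀ A' μ x)
          + wsup 1 (fun p : {p : ℕ × (Site d × Fin d) // p.1 ≤ m ∧ p.2 ∈ Λb m p.1} =>
          linCovIter L U₀ (iEta η A') p.1.1 p.1.2.1 p.1.2.2)) + Sg)
    -- Proposition 3's windows at `(α₀, α₂ := c⋆)` not implied by the JOIN's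
    {C₂ : ℝ} (hside : 36 * d * B₈ * cs ≤ 1 / 2)
    (hC₂ : 8 * (131072 * ((d : ℝ) + 1) ^ 2) * Real.exp (4 * (800 * ((d : ℝ) + 1) ^ 2 * ((d : ℝ) + 4)) * ((L : ℝ) ^ 2 * α₀))
      * (L : ℝ) ^ 2 ≤ C₂)  -- EDITION γ: the L²-scaled (1.56) remainder constant
    (h61 : 2 * cs ^ 2 + 20 * d * α₀ * cs + 2 * C₂ * cs ^ 2 ≤ α₀ + α₁) (hsmall₁ : (d : ℝ) * L * α₁ ≤ 1 / 8)
    -- the [4] LETTERS at `(m + 1, U₀)`, displayed as the JOIN reads them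
    (g Δ : (Site d → 𝔸) →ₗ[ℂ] (Site d → 𝔸)) (q : (Site d → 𝔸) →ₗ[ℂ] (ℕ → Site d → 𝔸)) (qs : (ℕ → Site d → 𝔸) →ₗ[ℂ] (Site d → 𝔸))
    (Aw c : (ℕ → Site d → 𝔸) →ₗ[ℂ] (ℕ → Site d → 𝔸))
    (g_rightΩ : ∀ x, (∀ (z : Site d) (i : Fin d), x (z + (P : ℤ) • e i) = x z) → ∀ y ∈ Ω 0, (Δ (g x) + qs (Aw (q (g x)))) y = x y)
    (c_range : ∀ f, (∀ (z : Site d) (i : Fin d), f (z + (P : ℤ) • e i) = f z) → q (g (g (qs (c (q f))))) = q f)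
    -- the torus: every `Lʲ ∣ P`, shift-invariant `Λ_j`, periodic `Ω_j`; periodicity-preserving `G′`, `Q′ᵀCQ′` ((P) laws)
    (hdiv : ∀ j, j ≤ m + 1 → ((L : ℤ) ^ j ∣ (P : ℤ)))
    (hΛ : ∀ j, j ≤ m + 1 → ∀ (y : Site d) (i : Fin d), y + ((P : ℤ) / (L : ℤ) ^ j) • e i ∈ Λs (m + 1) j ↔ y ∈ Λs (m + 1) j)
    (hΩp : ∀ j, j ≤ m → IsPeriodic P (fun x : Site d => x ∈ Ω j))
    (hGper : ∀ (f : Site d → 𝔸) (z : Site d) (i : Fin d), g f (z + (P : ℤ) • e i) = g f z)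
    (hqcq_per : ∀ f : Site d → 𝔸, (∀ (z : Site d) (i : Fin d), f (z + (P : ℤ) • e i) = f z) →
      ∀ (z : Site d) (i : Fin d), qs (c (q f)) (z + (P : ℤ) • e i) = qs (c (q f)) z)
    (hΔ : ∀ (f : Site d → 𝔸), ∀ x ∈ Ω 0, Δ f x = covLap η U₀ ((Ω 0).indicator f) x)
    (hqs : ∀ (μ : ℕ → Site d → 𝔸), ∀ x ∈ Ω 0, qs μ x = QT L (m + 1) (Λs (m + 1)) U₀ μ x)
    (hq : ∀ (f : Site d → 𝔸) (j : ℕ), j ≤ m + 1 → ∀ y ∈ Λs (m + 1) j, q f j y = QprimeIter (zdBlocking d L) (bgT L U₀) j f y)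
    (H' : XSpace d (m + 1) 𝔸 →ₗ[ℂ] (Site d → 𝔸)) {B₀'H B₂' BG BR : ℝ} (hB₀'H : 0 < B₀'H) (hB₂' : 0 ≤ B₂') (hBG : 0 ≤ BG) (hBR : 0 ≤ BR)
    (hH0 : ∀ (X : XSpace d (m + 1) 𝔸) (x : Site d), ‖H' X x‖ ≤ B₀'H * ‖X‖)
    (hH1 : ∀ j, j ≤ m + 1 → ∀ (X : XSpace d (m + 1) 𝔸), ∀ p ∈ {b : Site d × Fin d | SideTouches (Ω j) b.1 b.2},
      wt L η j * ‖covDerivFwd η U₀ p.2 (H' X) p.1‖ ≤ B₀'H * ‖X‖)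
    (hH2 : ∀ X : XSpace d (m + 1) 𝔸, Bd2 L η (m + 1) Ω (covLap η U₀ (H' X)) (B₂' * ‖X‖))
    (hHsupp : ∀ (X : XSpace d (m + 1) 𝔸) (x : Site d), x ∉ Ω 0 → H' X x = 0)
    (hHequiv : ∀ X Y : XSpace d (m + 1) 𝔸, (∀ p, Y p = -star (X p)) → ∀ x, H' Y x = -star (H' X x))
    (hHper : ∀ X : XSpace d (m + 1) 𝔸, (∀ (p : Fin (m + 1 + 1) × Site d) (i : Fin d), X (p.1, p.2 + ((P : ℤ) / (L : ℤ) ^ (p.1 : ℕ)) • e i) = X p) →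
      ∀ (z : Site d) (i : Fin d), H' X (z + (P : ℤ) • e i) = H' X z)
    (hQH : ∀ (Y : XSpace d (m + 1) 𝔸), (∀ (p : Fin (m + 1 + 1) × Site d) (i : Fin d), Y (p.1, p.2 + ((P : ℤ) / (L : ℤ) ^ (p.1 : ℕ)) • e i) = Y p) →
      ∀ (j : ℕ) (hj : j ≤ m + 1) (y : Site d), y ∈ Λs (m + 1) j →
      QprimeIter (zdBlocking d L) (bgT L U₀) j (H' Y) y = Y (⟨j, Nat.lt_succ_of_le hj⟩, y))
    (hG : ∀ (f : Site d → 𝔸) (r : ℝ), 0 ≤ r → Bd2 L η (m + 1) Ω f r →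
      (∀ x, ‖g f x‖ ≤ BG * r) ∧ ∀ j, j ≤ m + 1 → ∀ p ∈ {b : Site d × Fin d | SideTouches (Ω j) b.1 b.2},
        wt L η j * ‖covDerivFwd η U₀ p.2 (g f) p.1‖ ≤ BG * r)
    (hGsupp : ∀ (f : Site d → 𝔸) (x : Site d), x ∉ Ω 0 → g f x = 0)
    (hGreal : ∀ f : Site d → 𝔸, (∀ j, j ≤ m + 1 → ∀ x ∈ Ω j, IsSelfAdjoint (f x)) → ∀ x, IsSelfAdjoint (g f x))
    (hRbd : ∀ (f : Site d → 𝔸) (r : ℝ), 0 ≤ r → Bd2 L η (m + 1) Ω f r → Bd2 L η (m + 1) Ω (f - g (qs (c (q (g f))))) (BR * r))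
    (hRreal : ∀ f : Site d → 𝔸, (∀ j, j ≤ m + 1 → ∀ x ∈ Ω j, IsSelfAdjoint (f x)) →
      ∀ j, j ≤ m + 1 → ∀ x ∈ Ω j, IsSelfAdjoint ((f - g (qs (c (q (g f))))) x))
    -- the JOIN's scalar windows, one-for-one (`αP := α₀`, `α₄ := 8B₀′c⋆`; `cB cA cDA` free above their datum values)
    {cB cA cDA : ℝ} (hcBlo : L * cs ≤ cB) (hcAlo : L * cs ≤ cA) (hcDAlo : (d : ℝ) * (L : ℝ) ^ 2 * (cs + 2 * Sg) ≤ cDA)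
    (hα3 : C0 d * α₀ ≤ 1 / 3) (hα4 : 4 * α₀ ≤ c2' d L)
    (hsmall : Real.exp (4 * (800 * ((d : ℝ) + 1) ^ 2 * ((d : ℝ) + 4)) * α₀) * (1 + 8 * (131072 * ((d : ℝ) + 1) ^ 2) * cB) ≤ 2)
    (hc₃ : 2 * cB ≤ c3 d L) (hsc : 2048 * (d : ℝ) * cB ≤ 1) (hα₃' : 40 * d * cB ≤ 1 / 200)
    (hs₁ : 200 * C6 d * (2 * α₄) ≤ 1) (hs₂ : 12000 * ((d : ℝ) + 1) * L * (2 * α₄) ≤ 1)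
    (hs₃ : C4G d L * (α₀ + 40 * d * cB + 4 * (2 * α₄)) ≤ 1)
    (hs₄ : 1024 * ((d : ℝ) + 1) * ((d : ℝ) + 4) * L ^ 2 * α₀ ≤ 1) (hs₅ : 32 * ((d : ℝ) + 1) ^ 2 * C6 d * L ^ 2 * α₀ ≤ 1)
    (hs₆ : 16 * d * C5' d * C6 d * (L : ℝ) ^ 2 * α₀ ≤ 1) (hs₇ : 8 * d * C6 d * L * α₀ ≤ 1)
    (hsm : 40 * d * cB + α₄ ≤ 1 / (4 * B₀'H * (2 * C2p d))) (hprod8 : 2 * C6 d * (40 * d * cB + 4 * α₄) ≤ 1 / 8)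
    {hE hE₂ lE lE₂ : ℝ} (hE_def : hE = B₀'H * (C2p d * (40 * d * cB + α₄) * α₄)) (hE₂_def : hE₂ = B₂' * (C2p d * (40 * d * cB + α₄) * α₄))
    (lE_def : lE = B₀'H * (4 * C2p d * (40 * d * cB + 2 * α₄))) (lE₂_def : lE₂ = B₂' * (4 * C2p d * (40 * d * cB + 2 * α₄)))
    (hcA' : cA ≤ 1 / 13) (ha₁' : α₄ / 4 + hE ≤ 1 / 24) (hb₁' : α₄ / 4 + hE ≤ 1 / 140) (hθ : 10 * (α₄ / 4 + hE) * BR ≤ 1 / 2)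
    -- EDITION γ: [3] Prop. 4's windows of the (1.42)∕(1.56) steps ONE LEVEL LOWER, at `(L²α₀, c_B)` (`c_B ≥ L·c⋆`)
    (hα3L : C0 d * ((L : ℝ) ^ 2 * α₀) ≤ 1 / 3) (hα4L : 4 * ((L : ℝ) ^ 2 * α₀) ≤ c2' d L)
    (hsmallL : Real.exp (4 * (800 * ((d : ℝ) + 1) ^ 2 * ((d : ℝ) + 4)) * ((L : ℝ) ^ 2 * α₀)) * (1 + 8 * (131072 * ((d : ℝ) + 1) ^ 2) * cB) ≤ 2)
    (h103 : BG * Mc d BR (α₄ / 4 + hE) cA (hE₂ + mf / 2) cDA ≤ α₄ / 4)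
    (h106 : BG * Kc d BR (α₄ / 4 + hE) cA (hE₂ + mf / 2) cDA lE₂ (1 + lE) (1 + lE) ≤ 1 / 2) :
    ∃ (v : Site d → 𝔸ˣ) (lam : Site d → 𝔸), (∀ x, v x ∈ unitaryUnits 𝔸) ∧ (∀ x, x ∉ Ω 0 → v x = 1) ∧
      (∀ j, j ≤ m + 1 → ∀ b ∈ {b : Site d × Fin d | SideTouches (Ω j) b.1 b.2}, (v b.1 : 𝔸) = ((gaugeExp lam b.1 : 𝔸ˣ) : 𝔸) ∧
        (v (b.1 + e b.2) : 𝔸) = ((gaugeExp lam (b.1 + e b.2) : 𝔸ˣ) : 𝔸)) ∧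
      (∀ j, j ≤ m + 1 → ∀ b ∈ {b : Site d × Fin d | SideTouches (Ω j) b.1 b.2},
        ‖lam b.1‖ ≤ (8 * B₀' * (5 * (d : ℝ) * L * B₈) * (α₀ + α₁)) ∧
          ((L : ℝ) ^ j * η) * ‖covDerivFwd η U₀ b.2 lam b.1‖ ≤ (8 * B₀' * (5 * (d : ℝ) * L * B₈) * (α₀ + α₁))) ∧
      LanF146 L k η (Ω 0) Λs U₀ f (m + 1) (mgauge U₀ v⁻¹ U₁) ∧ Restr129 L (m + 1) (Λs (m + 1)) U₀ (u₁ * v) ∧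
      IsPeriodic P v := by
  -- two of the windows in the adapter's currency: `α₄ ≤ 1/84` (from `hs₁`, `C₆ ≥ 2`) and `c⋆ ≤ 1/12` (from `hcBlo`, `hα₃'`)
  have hsum : 0 ≤ α₀ + α₁ := by linarith
  have hcs0 : 0 ≤ cs := by rw [hcs_def]; positivity
  have hα₄0 : 0 ≤ α₄ := by rw [hα₄_def]; positivity
  have hC6 : (2 : ℝ) ≤ C6 d := by unfold C6; linarith [B7Prop10Flat.one_le_C5 (d := d)]
  have hα84 : α₄ ≤ 1 / 84 := by
    have h1 : 400 * (C6 d * α₄) ≤ 1 := by linarith only [hs₁]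
    have h2 : 2 * α₄ ≤ C6 d * α₄ := mul_le_mul_of_nonneg_right hC6 hα₄0
    linarith only [h1, h2]
  have hd1 : (1 : ℝ) ≤ d := by exact_mod_cast (show 1 ≤ d by omega)
  have hL1 : (1 : ℝ) ≤ L := by exact_mod_cast (show 1 ≤ L by omega)
  have hcs12 : cs ≤ 1 / 12 := by
    have h1 : cs ≤ L * cs := le_mul_of_one_le_left hcs0 hL1
    have h2 : L * cs ≤ cB := hcBlo
    have h3 : cB ≤ (d : ℝ) * cB := le_mul_of_one_le_left (hcs0.trans (h1.trans h2)) hd1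
    have h4 : 40 * ((d : ℝ) * cB) ≤ 1 / 200 := by linarith only [hα₃']
    linarith only [h1, h2, h3, h4]
  have hbody := sockHFP_body_of_join_RD_src_γ'_per hd2 hL hη (P : ℤ)
    hΩ hbox hclass hm1 hmk htower hlt htop htowm hα₀ hα₁ hB₈ hB₀' hcs_def hα₄_def hU₀ hU' h33 h34 hAx h135
    hu₁ hW h129 (fun n W => LanF146 L k η (Ω 0) Λs U₀ f n W) hLan hdat hSg
    (fun A' hA'p => SH59m A' (isPeriodic_of_forall_shift_e hA'p)) hmf hfB hfsa (per_dir_of_isPeriodic hfp) hside hC₂ h61 hsmall₁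
    g Δ q qs Aw c g_rightΩ c_range hdiv hΛ (fun j hj x κ i => sideTouches_add_zsmul_iff (hΩp j hj) x (e i) κ)
    (per_dir_of_isPeriodic hU₀p) (per_dir_of_isPeriodic hAp) (per_dir_of_isPeriodic hu₁p) hGper hqcq_per hΔ hqs hq H' hB₀'H hB₂' hBG hBR
    hH0 hH1 hH2 hHsupp hHequiv hHper hQH hG hGsupp hGreal hRbd hRreal
    hcBlo hcAlo hcDAlo hα3 hα4 hsmall hc₃ hsc hα₃' hs₁ hs₂ hs₃ hs₄ hs₅ hs₆ hs₇ hsm hprod8 hE_def hE₂_def lE_def lE₂_def hcA' ha₁' hb₁' hθ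
    hα3L hα4L hsmallL h103 h106
  obtain ⟨lam, hlamP, hsa, hoff, h108, hmult, h129'⟩ := hbody
  subst hα₄_def
  exact sP5_step_of_HFP_src_per hd2 hη L k m hU₀ hα84 (hcs_def ▸ hcs12) Ω Λs u₁ U₁ A f hf138 (hcs_def ▸ hdat)
    ⟨lam, hlamP, hsa, hoff, h108, hmult, h129'⟩

end Step

/-! ## §3 T5's `SP5base` ∃-clause (instance (ii)) at ONE member, ONE periodic pair and ONE periodic source, from the nested periodic sourced
base storey (`B8SockHFPRDSrcPer.sockHFP₀_body_of_join_RD_src_per`) -/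

section Base

variable {𝔸 : Type*} [CStarAlgebra 𝔸] [Nontrivial 𝔸]

/-- ★★ **PROPOSITION 5, EXISTENCE (1.107)–(1.108) AT LEVEL `1` FROM THE DATUM `u₁ = 1`, `U₁ = U′` (p. 89 «They are satisfied in the case k = 1 also, if we
take u₁ = 1, U′ = U₁»), NESTED PERIODIC DOMAINS — THE ∃-CLAUSE OF pub-ymgap's GUARDED SOCKET `SP5base` (T5 :117–:130, `LanF := LanF146 … f`) AT ONE MEMBER
AND ONE PERIODIC UNITARY PAIR.**  For `d, L ≥ 2`, `k ≥ 1`, a member with nesting and towers at level `1`, a `P`-periodic unitary pair `(U₀, U′)` in Theorem 4's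
regime ((1.33), (1.34), all-truncation axial gauge) with the (1.66)₀ side clause `|U′ − 1| ≤ α₁` on the bonds of the plaquettes touching `Ω₀` (so, `B₁ = 5dLB₈`
being «not too small», `2 ≤ 5dLB₈`: `U′ = e^{iηA₀}` there with `A₀ = (iη)⁻¹ log U′` Hermitian PERIODIC, `|A₀| ≤ 2α₁η⁻¹ ≤ c⋆η⁻¹`), `Ω₀` periodic, the torus data
at level `1`, THE [4] LETTERS AT `(1, U₀)` WITH THEIR LAWS (module docstring) and the JOIN's scalar windows one-for-one at `α₄ = 8B₀′(5dLB₈)(α₀ + α₁)`: THERE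
ARE a unitary `P`-PERIODIC `v = e^{iλ}`, `= 1` off `Ω₀`, reading `e^{iλ}` on the bonds of the plaquettes touching `Ω_j` (`j ≤ 1`), with (1.108) graded at `α₄`,
the sourced gauge predicate `LanF146 … f 1` for `U′^{v⁻¹}` and (1.29) for `1·v` at one level — the ∃-clause of `SP5base` at instance (ii).  PROOF:
`sP5base_of_HFP_src_per` on the sourced base storey `B8SockHFPRDSrcPer.sockHFP₀_body_of_join_RD_src_per` at the datum `A₀`.
[cite: Balaban1985RegularSpaces, Prop. 5 (1.107)–(1.108) p.94, p.89, (1.66) p.88, Thm 4 p.88, Thm 8 (1.146) p.101, (1.86)–(1.88) p.91, (1.38) p.82, (1.29) p.81, p.77 («Ω_j ⊂ T_η»); Balaban1985BackgroundPropagators, Thm 3.1 p.397, (3.19) p.393; Balaban1985Averaging, Prop. 10, (213) p.48] -/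
theorem sP5base_body_of_join_src_per (hd2 : 2 ≤ d) {L : ℕ} (hL : 2 ≤ L) {η : ℝ} (hη : 0 < η) (P : ℕ) {k : ℕ} (hk : 1 ≤ k)
    -- the member's geometry
    {Ω : ℕ → Set (Site d)} (hΩ : ∀ j, Ω (j + 1) ⊆ Ω j) {Λs : ℕ → ℕ → Set (Site d)}
    (htower : ∀ j, j ≤ 1 → ∀ y ∈ Λs 1 j, ∀ x, InBox (tlo L y j) (thi L y j) x → x ∈ Ω j)
    -- the socket's antecedents: constants (`B₁ := 5dL·B₈` «not too small», p. 89: `2 ≤ 5dLB₈`), (1.33), (1.34), the (1.66)₀ side clause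
    {α₀ α₁ B₈ B₀' cs α₄ : ℝ} (hα₀ : 0 < α₀) (hα₁ : 0 < α₁) (hB₈ : 0 < B₈) (hB₀' : 0 < B₀') (hB : 2 ≤ 5 * (d : ℝ) * L * B₈)
    (hcs_def : cs = 5 * (d : ℝ) * L * B₈ * (α₀ + α₁)) (hα₄_def : α₄ = 8 * B₀' * (5 * (d : ℝ) * L * B₈) * (α₀ + α₁))
    {U₀ U' : Site d → Fin d → 𝔸ˣ} (hU₀ : ∀ x κ, U₀ x κ ∈ unitaryUnits 𝔸) (hU' : ∀ x κ, U' x κ ∈ unitaryUnits 𝔸)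
    (hU₀p : IsPeriodic P U₀) (hU'p : IsPeriodic P U')
    (h33 : InAk L k η α₀ Ω U₀) (h34 : InAk L k η α₀ Ω (mulCfg U' U₀)) (hAx : ∀ m', m' ≤ k → InAx L m' (Λs m') U₀ (mulCfg U' U₀))
    (h66 : ∀ b ∈ {b : Site d × Fin d | SideTouches (Ω 0) b.1 b.2}, ‖((U' b.1 b.2 : 𝔸ˣ) : 𝔸) - 1‖ ≤ α₁)
    -- THEOREM 8's SOURCE `f`: in `R(U₀)` at the top level, Hermitian, `Bd2`-size `m_f` on `Ω₀ ⊇ Ω₁`, `P`-PERIODIC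
    {f : Site d → 𝔸} (hf138 : InR138 L k η (Ω 0) (Λs k) U₀ f) {mf : ℝ} (hmf : 0 ≤ mf) (hfB : Bd2 L η 1 Ω f mf)
    (hfsa : ∀ j, j ≤ 1 → ∀ x ∈ Ω j, IsSelfAdjoint (f x)) (hfp : IsPeriodic P f)
    -- the [4] LETTERS at `(1, U₀)`, displayed as the JOIN reads them
    (g Δ : (Site d → 𝔸) →ₗ[ℂ] (Site d → 𝔸)) (q : (Site d → 𝔸) →ₗ[ℂ] (ℕ → Site d → 𝔸)) (qs : (ℕ → Site d → 𝔸) →ₗ[ℂ] (Site d → 𝔸))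
    (Aw c : (ℕ → Site d → 𝔸) →ₗ[ℂ] (ℕ → Site d → 𝔸))
    (g_rightΩ : ∀ x, (∀ (z : Site d) (i : Fin d), x (z + (P : ℤ) • e i) = x z) → ∀ y ∈ Ω 0, (Δ (g x) + qs (Aw (q (g x)))) y = x y)
    (c_range : ∀ f, (∀ (z : Site d) (i : Fin d), f (z + (P : ℤ) • e i) = f z) → q (g (g (qs (c (q f))))) = q f)
    -- the torus: every `Lʲ ∣ P`, shift-invariant `Λ_j`, periodic `Ω₀`; periodicity-preserving `G′`, `Q′ᵀCQ′` ((P) laws)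
    (hdiv : ∀ j, j ≤ 1 → ((L : ℤ) ^ j ∣ (P : ℤ)))
    (hΛ : ∀ j, j ≤ 1 → ∀ (y : Site d) (i : Fin d), y + ((P : ℤ) / (L : ℤ) ^ j) • e i ∈ Λs 1 j ↔ y ∈ Λs 1 j)
    (hΩp : IsPeriodic P (fun x : Site d => x ∈ Ω 0))
    (hGper : ∀ (f : Site d → 𝔸) (z : Site d) (i : Fin d), g f (z + (P : ℤ) • e i) = g f z)
    (hqcq_per : ∀ f : Site d → 𝔸, (∀ (z : Site d) (i : Fin d), f (z + (P : ℤ) • e i) = f z) →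
      ∀ (z : Site d) (i : Fin d), qs (c (q f)) (z + (P : ℤ) • e i) = qs (c (q f)) z)
    (hΔ : ∀ (f : Site d → 𝔸), ∀ x ∈ Ω 0, Δ f x = covLap η U₀ ((Ω 0).indicator f) x)
    (hqs : ∀ (μ : ℕ → Site d → 𝔸), ∀ x ∈ Ω 0, qs μ x = QT L 1 (Λs 1) U₀ μ x)
    (hq : ∀ (f : Site d → 𝔸) (j : ℕ), j ≤ 1 → ∀ y ∈ Λs 1 j, q f j y = QprimeIter (zdBlocking d L) (bgT L U₀) j f y)
    (H' : XSpace d 1 𝔸 →ₗ[ℂ] (Site d → 𝔸)) {B₀'H B₂' BG BR : ℝ} (hB₀'H : 0 < B₀'H) (hB₂' : 0 ≤ B₂') (hBG : 0 ≤ BG) (hBR : 0 ≤ BR)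
    (hH0 : ∀ (X : XSpace d 1 𝔸) (x : Site d), ‖H' X x‖ ≤ B₀'H * ‖X‖)
    (hH1 : ∀ j, j ≤ 1 → ∀ (X : XSpace d 1 𝔸), ∀ p ∈ {b : Site d × Fin d | SideTouches (Ω j) b.1 b.2},
      wt L η j * ‖covDerivFwd η U₀ p.2 (H' X) p.1‖ ≤ B₀'H * ‖X‖)
    (hH2 : ∀ X : XSpace d 1 𝔸, Bd2 L η 1 Ω (covLap η U₀ (H' X)) (B₂' * ‖X‖))
    (hHsupp : ∀ (X : XSpace d 1 𝔸) (x : Site d), x ∉ Ω 0 → H' X x = 0)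
    (hHequiv : ∀ X Y : XSpace d 1 𝔸, (∀ p, Y p = -star (X p)) → ∀ x, H' Y x = -star (H' X x))
    (hHper : ∀ X : XSpace d 1 𝔸, (∀ (p : Fin (1 + 1) × Site d) (i : Fin d), X (p.1, p.2 + ((P : ℤ) / (L : ℤ) ^ (p.1 : ℕ)) • e i) = X p) →
      ∀ (z : Site d) (i : Fin d), H' X (z + (P : ℤ) • e i) = H' X z)
    (hQH : ∀ (Y : XSpace d 1 𝔸), (∀ (p : Fin (1 + 1) × Site d) (i : Fin d), Y (p.1, p.2 + ((P : ℤ) / (L : ℤ) ^ (p.1 : ℕ)) • e i) = Y p) →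
      ∀ (j : ℕ) (hj : j ≤ 1) (y : Site d), y ∈ Λs 1 j →
      QprimeIter (zdBlocking d L) (bgT L U₀) j (H' Y) y = Y (⟨j, Nat.lt_succ_of_le hj⟩, y))
    (hG : ∀ (f : Site d → 𝔸) (r : ℝ), 0 ≤ r → Bd2 L η 1 Ω f r →
      (∀ x, ‖g f x‖ ≤ BG * r) ∧ ∀ j, j ≤ 1 → ∀ p ∈ {b : Site d × Fin d | SideTouches (Ω j) b.1 b.2},
        wt L η j * ‖covDerivFwd η U₀ p.2 (g f) p.1‖ ≤ BG * r)
    (hGsupp : ∀ (f : Site d → 𝔸) (x : Site d), x ∉ Ω 0 → g f x = 0)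
    (hGreal : ∀ f : Site d → 𝔸, (∀ j, j ≤ 1 → ∀ x ∈ Ω j, IsSelfAdjoint (f x)) → ∀ x, IsSelfAdjoint (g f x))
    (hRbd : ∀ (f : Site d → 𝔸) (r : ℝ), 0 ≤ r → Bd2 L η 1 Ω f r → Bd2 L η 1 Ω (f - g (qs (c (q (g f))))) (BR * r))
    (hRreal : ∀ f : Site d → 𝔸, (∀ j, j ≤ 1 → ∀ x ∈ Ω j, IsSelfAdjoint (f x)) →
      ∀ j, j ≤ 1 → ∀ x ∈ Ω j, IsSelfAdjoint ((f - g (qs (c (q (g f))))) x))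
    -- the JOIN's scalar windows, one-for-one (`αP := α₀`, `α₄ := 8B₀′c⋆`; `cB cA cDA` free above their datum values, `cDA ≥ 2dL²c⋆` here)
    {cB cA cDA : ℝ} (hcBlo : L * cs ≤ cB) (hcAlo : L * cs ≤ cA) (hcDAlo : 2 * (d : ℝ) * (L : ℝ) ^ 2 * cs ≤ cDA)
    (hα3 : C0 d * α₀ ≤ 1 / 3) (hα4 : 4 * α₀ ≤ c2' d L)
    (hsmall : Real.exp (4 * (800 * ((d : ℝ) + 1) ^ 2 * ((d : ℝ) + 4)) * α₀) * (1 + 8 * (131072 * ((d : ℝ) + 1) ^ 2) * cB) ≤ 2)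
    (hc₃ : 2 * cB ≤ c3 d L) (hsc : 2048 * (d : ℝ) * cB ≤ 1) (hα₃' : 40 * d * cB ≤ 1 / 200)
    (hs₁ : 200 * C6 d * (2 * α₄) ≤ 1) (hs₂ : 12000 * ((d : ℝ) + 1) * L * (2 * α₄) ≤ 1)
    (hs₃ : C4G d L * (α₀ + 40 * d * cB + 4 * (2 * α₄)) ≤ 1)
    (hs₄ : 1024 * ((d : ℝ) + 1) * ((d : ℝ) + 4) * L ^ 2 * α₀ ≤ 1) (hs₅ : 32 * ((d : ℝ) + 1) ^ 2 * C6 d * L ^ 2 * α₀ ≤ 1)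
    (hs₆ : 16 * d * C5' d * C6 d * (L : ℝ) ^ 2 * α₀ ≤ 1) (hs₇ : 8 * d * C6 d * L * α₀ ≤ 1)
    (hsm : 40 * d * cB + α₄ ≤ 1 / (4 * B₀'H * (2 * C2p d))) (hprod8 : 2 * C6 d * (40 * d * cB + 4 * α₄) ≤ 1 / 8)
    {hE hE₂ lE lE₂ : ℝ} (hE_def : hE = B₀'H * (C2p d * (40 * d * cB + α₄) * α₄)) (hE₂_def : hE₂ = B₂' * (C2p d * (40 * d * cB + α₄) * α₄))
    (lE_def : lE = B₀'H * (4 * C2p d * (40 * d * cB + 2 * α₄))) (lE₂_def : lE₂ = B₂' * (4 * C2p d * (40 * d * cB + 2 * α₄)))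
    (hcA' : cA ≤ 1 / 13) (ha₁' : α₄ / 4 + hE ≤ 1 / 24) (hb₁' : α₄ / 4 + hE ≤ 1 / 140) (hθ : 10 * (α₄ / 4 + hE) * BR ≤ 1 / 2)
    (h103 : BG * Mc d BR (α₄ / 4 + hE) cA (hE₂ + mf / 2) cDA ≤ α₄ / 4)
    (h106 : BG * Kc d BR (α₄ / 4 + hE) cA (hE₂ + mf / 2) cDA lE₂ (1 + lE) (1 + lE) ≤ 1 / 2) :
    ∃ (v : Site d → 𝔸ˣ) (lam : Site d → 𝔸), (∀ x, v x ∈ unitaryUnits 𝔸) ∧ (∀ x, x ∉ Ω 0 → v x = 1) ∧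
      (∀ j, j ≤ 1 → ∀ b ∈ {b : Site d × Fin d | SideTouches (Ω j) b.1 b.2}, (v b.1 : 𝔸) = ((gaugeExp lam b.1 : 𝔸ˣ) : 𝔸) ∧
        (v (b.1 + e b.2) : 𝔸) = ((gaugeExp lam (b.1 + e b.2) : 𝔸ˣ) : 𝔸)) ∧
      (∀ j, j ≤ 1 → ∀ b ∈ {b : Site d × Fin d | SideTouches (Ω j) b.1 b.2},
        ‖lam b.1‖ ≤ (8 * B₀' * (5 * (d : ℝ) * L * B₈) * (α₀ + α₁)) ∧
          ((L : ℝ) ^ j * η) * ‖covDerivFwd η U₀ b.2 lam b.1‖ ≤ (8 * B₀' * (5 * (d : ℝ) * L * B₈) * (α₀ + α₁))) ∧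
      LanF146 L k η (Ω 0) Λs U₀ f 1 (mgauge U₀ v⁻¹ U') ∧ Restr129 L 1 (Λs 1) U₀ ((1 : Site d → 𝔸ˣ) * v) ∧
      IsPeriodic P v := by
  -- the adapter's windows: `α₄ ≤ 1/84`, `c⋆ ≤ 1/12`, and `2α₁ ≤ c⋆`, `α₁ ≤ 1/4` from `2 ≤ 5dLB₈`
  have hsum : 0 ≤ α₀ + α₁ := by linarith
  have hcs0 : 0 ≤ cs := by rw [hcs_def]; positivity
  have hα₄0 : 0 ≤ α₄ := by rw [hα₄_def]; positivity
  have hC6 : (2 : ℝ) ≤ C6 d := by unfold C6; linarith [B7Prop10Flat.one_le_C5 (d := d)]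
  have hα84 : α₄ ≤ 1 / 84 := by
    have h1 : 400 * (C6 d * α₄) ≤ 1 := by linarith only [hs₁]
    have h2 : 2 * α₄ ≤ C6 d * α₄ := mul_le_mul_of_nonneg_right hC6 hα₄0
    linarith only [h1, h2]
  have hd1 : (1 : ℝ) ≤ d := by exact_mod_cast (show 1 ≤ d by omega)
  have hL1 : (1 : ℝ) ≤ L := by exact_mod_cast (show 1 ≤ L by omega)
  have hcs12 : cs ≤ 1 / 12 := by
    have h1 : cs ≤ L * cs := le_mul_of_one_le_left hcs0 hL1
    have h2 : L * cs ≤ cB := hcBlo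
    have h3 : cB ≤ (d : ℝ) * cB := le_mul_of_one_le_left (hcs0.trans (h1.trans h2)) hd1
    have h4 : 40 * ((d : ℝ) * cB) ≤ 1 / 200 := by linarith only [hα₃']
    linarith only [h1, h2, h3, h4]
  have ha2 : 2 * α₁ ≤ cs := by
    have h1 : 2 * (α₀ + α₁) ≤ 5 * (d : ℝ) * L * B₈ * (α₀ + α₁) := mul_le_mul_of_nonneg_right hB hsum
    rw [hcs_def]; linarith only [h1, hα₀.le]
  have ha : α₁ ≤ 1 / 4 := by linarith only [ha2, hcs12]
  have hΩper : ∀ j, j ≤ 0 → ∀ (x : Site d) (κ : Fin d) (i : Fin d),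
      SideTouches (Ω j) (x + (P : ℤ) • e i) κ ↔ SideTouches (Ω j) x κ := fun j hj x κ i => by
    obtain rfl : j = 0 := Nat.le_zero.mp hj
    exact sideTouches_add_zsmul_iff hΩp x (e i) κ
  subst hα₄_def
  refine sP5base_of_HFP_src_per hd2 hη L k hU₀ hU' (per_dir_of_isPeriodic hU'p) hα84 hcs12 ha ha2 Ω Λs f hf138 h66 fun A hAper hdat => ?_
  obtain ⟨lam, hlamP, hsa, hoff, h108, hmult, h129'⟩ :=
    sockHFP₀_body_of_join_RD_src_per hd2 hL hη (P : ℤ) hk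
      hΩ htower hα₀ hα₁ hB₈ hB₀' hcs_def rfl hU₀ h33 h34 hAx hdat
      g Δ q qs Aw c g_rightΩ c_range hdiv hΛ hΩper (per_dir_of_isPeriodic hU₀p) hAper hGper hqcq_per hΔ hqs hq H' hB₀'H hB₂' hBG hBR
      hH0 hH1 hH2 hHsupp hHequiv hHper hQH hG hGsupp hGreal hRbd hRreal
      hcBlo hcAlo hcDAlo hα3 hα4 hsmall hc₃ hsc hα₃' hs₁ hs₂ hs₃ hs₄ hs₅ hs₆ hs₇ hsm hprod8 hE_def hE₂_def lE_def lE₂_def hcA' ha₁' hb₁' hθ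
      hmf hfB hfsa (per_dir_of_isPeriodic hfp) h103 h106
  exact ⟨lam, hlamP, hsa, hoff, h108, hmult, h129'⟩

end Base

#print axioms sP5_step_of_HFP_src_per
#print axioms sP5base_of_HFP_src_per
#print axioms sP5_body_of_join_src_γ'_per
#print axioms sP5base_body_of_join_src_per



end Literature.MathematicalPhysics.QuantumFieldTheory.Balaban1983to89.B8Prop5NestedServerSrcPerBody

end
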